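import Mathlib
import HarnessLib
import Summits.ValiantsHypothesis.ValiantsHypothesis.Theorems.ValuativeGCTValuativeFlipPaddingTransfer

/-!
# `ValuativeGCT.TailFlip` (stmt-ValiantsHypothesis-15687), line `boundary-ray-collapse`:
# the registered stub `stub_scalarTwistInheritance` — a scalar twist inherits from a padded base

The ENGINE of the boundary-ray collapse (shape-agnostic).  Letters: inner size `n`, padded base level
`m₀` (`n < m₀`), padding `j`, degree `δ`, `λ ⊢ m₀·δ` with at most `m₀²` parts,
`P_{n,m}(λ) = orbitMultiplicity ℂ (paddedPerFormLex ℂ n m) m (partitionWeightLex m λ)` the multiplicity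
of the dual weight `λ*` in `ℂ[Δ_m(X₀₀^{m-n} per_n)]`.  If BIP's padding twist
`Δ_j : x^e ↦ ((e_top + j)!/e_top!) · x^e` acts on the evaluation of EVERY weight-`λ*` highest-weight
vector at EVERY column-normalised point `A · X₀₀^{m₀-n} per_n` (`A · X₀₀ = X_top`) as one nonzero
scalar `s`, then `P_{n,m₀}(λ) ≤ P_{n,m₀+j}(λ♯(m₀+j))`, `λ♯(m₀+j) = rowLift λ j`.

Proof: a full untwisted certificate of size `D = P_{n,m₀}(λ)` on column-normalised points exists at
level `m₀` (`exists_evalCertificate_col`); by hypothesis the twisted evaluation matrix is `s •` the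
untwisted one, so its determinant is `s ^ D · det ≠ 0` (`Matrix.det_smul`); the `m`-general twisted
inheritance `twistedInheritance_padded` lifts it to level `m₀ + j`.

Sources: BLMW, SIAM J. Comput. 40 (2011) §6.4 Problem 6.10; Ikenmeyer–Panova, Adv. Math. 319 (2017)
Prop. 2.6(b); Bürgisser–Ikenmeyer–Panova, J. AMS 32 (2019) Lemma 5.2–5.3, Thm. 5.4.
-/

-- the summit-side namespace `Summit.ValiantsHypothesis.ValiantsHypothesis.…` repeats a component by convention (D-0022)
set_option linter.dupNamespace false

namespace Summit.ValiantsHypothesis.ValiantsHypothesis.Theorems.TailFlip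

open MvPolynomial
open scoped BigOperators Matrix
open Literature.NumberTheory.DiophantineGeometry
open Literature.Computability.AlgebraicComplexity
open Literature.Computability.Complexity
open Summit.ValiantsHypothesis.ValiantsHypothesis.Theorems.ValuativeFlip

noncomputable section

/-- **stub_scalarTwistInheritance** (engine of the boundary-ray collapse; any shape, no `λ₂`
hypothesis).  For `n < m₀`, `λ ⊢ m₀·δ` with at most `m₀²` parts, a padding `j` and a nonzero scalar
`s` such that the `Δ_j`-twisted evaluation of EVERY weight-`λ*` highest-weight vector at EVERY
column-normalised point `A · X₀₀^{m₀-n} per_n` is `s` times the untwisted one: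
`P_{n,m₀}(λ) ≤ P_{n,m₀+j}(λ♯(m₀+j))`.  A full untwisted certificate of size `D = P_{n,m₀}(λ)` on
column-normalised points (`exists_evalCertificate_col` with `i₀ = (0,0)`, `t = topMatIdx m₀`) has
twisted matrix `s •` the untwisted one, of determinant `s ^ D · det ≠ 0` (`Matrix.det_smul`), and
`twistedInheritance_padded` lifts it to level `m₀ + j`.
[BLMW 2011 §6.4 Problem 6.10; Ikenmeyer–Panova 2017 Prop. 2.6(b); Bürgisser–Ikenmeyer–Panova 2019
Thm. 5.4] -/
theorem stub_scalarTwistInheritance :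
    ∀ (n m₀ j δ : ℕ) [NeZero m₀] [NeZero (m₀ + j)], n < m₀ → ∀ (lam : Nat.Partition (m₀ * δ)),
      lam.parts.card ≤ m₀ * m₀ → ∀ s : ℂ, s ≠ 0 →
      (∀ F ∈ highestWeightSpace (coordRep (MatIdx m₀) ℂ m₀) (partitionWeightLex m₀ lam),
        ∀ A : Matrix (MatIdx m₀) (MatIdx m₀) ℂ,
          (∀ t, A t (toLex ((0 : Fin m₀), (0 : Fin m₀))) = if t = topMatIdx m₀ then 1 else 0) →
          aeval (fun e : DegIdx (MatIdx m₀) m₀ =>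
              (((e.1 (topMatIdx m₀) + j).descFactorial j : ℕ) : ℂ) *
                coeff e.1 (linSubst (MatIdx m₀) ℂ A (paddedPerFormLex ℂ n m₀))) F =
            s * aeval (fun e : DegIdx (MatIdx m₀) m₀ =>
              coeff e.1 (linSubst (MatIdx m₀) ℂ A (paddedPerFormLex ℂ n m₀))) F) →
      orbitMultiplicity ℂ (paddedPerFormLex ℂ n m₀) m₀ (partitionWeightLex m₀ lam) ≤
        orbitMultiplicity ℂ (paddedPerFormLex ℂ n (m₀ + j)) (m₀ + j)
          (partitionWeightLex (m₀ + j) (rowLift lam j)) := by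
  intro n m₀ j δ _ _ hnm lam hlam s hs hscalar
  classical
  set D := orbitMultiplicity ℂ (paddedPerFormLex ℂ n m₀) m₀ (partitionWeightLex m₀ lam) with hD
  -- a full untwisted certificate on column-normalised points at the padded base level `m₀`
  obtain ⟨F, A, hF, -, hAcol, hdet⟩ := exists_evalCertificate_col (paddedPerFormLex ℂ n m₀)
    (NeZero.ne m₀) (partitionWeightLex m₀ lam) (toLex ((0 : Fin m₀), (0 : Fin m₀))) (topMatIdx m₀)
    (le_topMatIdx m₀) (le_refl D)
  -- the twisted evaluation matrix is `s •` the untwisted one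
  have hmat : (Matrix.of fun i l : Fin D => aeval (fun e : DegIdx (MatIdx m₀) m₀ =>
        (((e.1 (topMatIdx m₀) + j).descFactorial j : ℕ) : ℂ) *
          coeff e.1 (linSubst (MatIdx m₀) ℂ (A l) (paddedPerFormLex ℂ n m₀))) (F i)) =
      s • Matrix.of fun i l : Fin D =>
        aeval (formCoeff m₀ (linSubst (MatIdx m₀) ℂ (A l) (paddedPerFormLex ℂ n m₀))) (F i) := by
    ext i l
    rw [Matrix.smul_apply, Matrix.of_apply, Matrix.of_apply, smul_eq_mul,
      hscalar (F i) (hF i) (A l) (hAcol l)]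
    rfl
  -- hence nonsingular: `det = s ^ D · det ≠ 0`
  have hdet' : (Matrix.of fun i l : Fin D => aeval (fun e : DegIdx (MatIdx m₀) m₀ =>
        (((e.1 (topMatIdx m₀) + j).descFactorial j : ℕ) : ℂ) *
          coeff e.1 (linSubst (MatIdx m₀) ℂ (A l) (paddedPerFormLex ℂ n m₀))) (F i)).det ≠ 0 := by
    rw [hmat, Matrix.det_smul, Fintype.card_fin]
    exact mul_ne_zero (pow_ne_zero _ hs) hdet
  -- twisted inheritance at level `m₀` lifts the certificate to level `m₀ + j`
  exact twistedInheritance_padded n m₀ j δ (le_of_lt hnm) lam hlam D F hF A hAcol hdet'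

end

end Summit.ValiantsHypothesis.ValiantsHypothesis.Theorems.TailFlip
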